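/-
Copyright: the b2b-balaban T⁴-continuum CRUX team, row NE7b OWNER lineage `t4-ne7b-p1` (gen 141). Project licence.
-/
import Summits.QuantumFields.BalabanUV.T4Continuum.Spine.NE7b.SupWhitenedHessianGradientCovariance

/-!
# THE TWO-POINT PIECES OF `∂³W`, ENTRYWISE, FOR A GENERAL `Γ = AAᵀ` AND ANY ADMISSIBLE `D` (SCOPING (d13)(1), first file): the
# background-free ENTRY majorants behind (469)∕(473)'s row letters.  For the Hessian-entry observable `G_{xy} = U″(Aξ+ψ)[e_x,e_y]` (vector
# `g^{xy}_w = Σ_u|A_{uw}|K3_{xyu}`, (469)) and the gradient component `F_z = U′(Aξ+ψ)[e_z]` (vector `b^z_w = Σ_u|A_{uw}|Hk_{zu}`, (456)),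
# (447)'s entry bound gives, for EVERY `D ≥ 0` with `δ + D·C ≤ D` (`C = HA∕(1−lamA)` off the diagonal),
#   `|Cov_ν(G_{xy}, F_z)| ≤ E_D(g^{xy}, b^z)`,   `|Cov_ν(F_x, G_{yz})| ≤ E_D(b^x, g^{yz})`,   `E_D(a,b) = Σ_w (Dᵀa)_w(Dᵀb)_w∕(1−lamA)`
# — NO dependence on the background `ψ`: these are the two-point ENTRIES of the output majorant `K3⁺` that puts the fluctuation step's third
# derivative back into the input format (the class map, (d13)(1)); in tilted form under `N(0,AAᵀ)` with the moment letters discharged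
# (row NE7b, node U5c; (447) `abs_cov_le_kernel_gibbs`, (456), (457), (458), (469) BY NAME; [folklore])

Cell `pub-balaban`, sub-cell `t4`, spine estimate NE7b (`T4WeightBudget.RelWeightBound`; the cell's OWN estimate — NOT PRINTED in
[Bałaban 1983–89], NOT PROVED).  Crux-route work under `Spine/NE7b/` by the row OWNER (`t4-ne7b-p1` gen 141, file (477)) under FREEZE
(0)'s crux-prover clause; NOTHING of Bałaban's is named as a Lean object, valued or asserted; no `T4Continuum/Support` leaf typed; no
`def`, no notation; zero `sorry`.  Imports (BY NAME): the OWNER's (469) `…SupWhitenedHessianGradientCovariance` (`hessian_obs_lipVec`;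
through it (458) `whitened_exp_integrable`∕`whitened_second_moment_integrable`, (457) `whitenedV_*`, `whitened_integrable_lebesgue`,
`whitened_tilted_eq_gauss`, `whitened_integral_eq`, (456) `whitened_obs_lipVec`, `whitened_cross_nonneg`, `whitened_J_rowsum_le`, (447)
`abs_cov_le_kernel_gibbs`).

WHAT IS PROVED ([folklore]; any admissible `D`):
* §1 raw (whitened Lebesgue tilted format): `hessgrad_cov_entry_raw`, `gradhess_cov_entry_raw`.
* §2 THE END under `N(0,AAᵀ)` (moment letters discharged, Dobrushin's row condition from the letters): **`hessgrad_cov_entry`**,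
  **`gradhess_cov_entry`**; §3 toy.

HONEST (what this is NOT).  Entries only; their fixed-slot double sums (the letters `k3r⁺, k3c⁺, k3m⁺`), the average and cumulant entries
and the assembled majorant are the next files; scalar skeleton ((A3), NC-NE7b-α UNRULED); nothing of Bałaban's asserted.  BY-NAME EFFECT
ON THE WALL: NONE.  NE7b NOT PRINTED ∕ NOT PROVED; spine PROVED 0∕9; rung (B)+1 — the programme's measures remain FINITE-torus statements;
NOT the mass gap, NOT Clay.  HONEST DEPENDENCY: continuum YM on T⁴ ⇐ BetaPertH ∧ nine spine estimates (0∕9 proved); BetaPertH ⇐ (D1) ∧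
(D4) ∧ CAP+tail; G-an2-4 gates asym, D1 and NE2∕3∕4.
-/

set_option autoImplicit false
set_option maxSynthPendingDepth 3

noncomputable section

namespace Summit.QuantumFields.BalabanUV.T4Continuum.NE7b.SupWhitenedTwoPointEntries

open MeasureTheory ProbabilityTheory Real Set Function Finset Matrix
open scoped BigOperators
open Literature.Probability.Distributions (matrixCLM)
open SupWhitenedMomentLetters (whitened_exp_integrable whitened_second_moment_integrable)
open SupWhitenedCovarianceKernelLetter (whitenedV_hasDerivAt whitenedV_floor whitenedV_ceiling whitenedV_cross whitenedV_continuous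
  whitened_integrable_lebesgue whitened_tilted_eq_gauss whitened_integral_eq)
open SupWhitenedFirstOrderLetters (whitened_obs_lipVec whitened_cross_nonneg whitened_J_rowsum_le)
open SupWhitenedHessianGradientCovariance (hessian_obs_lipVec)
open SupDobrushinCovarianceGibbs (abs_cov_le_kernel_gibbs)

variable {ι κ : Type} [Fintype ι] [DecidableEq ι] [Fintype κ] [DecidableEq κ]

variable {U : EuclideanSpace ℝ ι → ℝ} {U' : EuclideanSpace ℝ ι → EuclideanSpace ℝ ι →L[ℝ] ℝ}
  {U'' : EuclideanSpace ℝ ι → EuclideanSpace ℝ ι →L[ℝ] EuclideanSpace ℝ ι →L[ℝ] ℝ}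
  {U₃ : EuclideanSpace ℝ ι → EuclideanSpace ℝ ι →L[ℝ] EuclideanSpace ℝ ι →L[ℝ] EuclideanSpace ℝ ι →L[ℝ] ℝ} {Hk : ι → ι → ℝ} {K3 : ι → ι → ι → ℝ}
  {A : Matrix ι κ ℝ} {D : κ → κ → ℝ} {γop κ₀ τ δ θ αr αc hr lamA γ : ℝ}

/-! ## §1. The raw entries (whitened Lebesgue tilted format, any admissible `D`) -/

/-- **`|Cov_ν(G_{xy}, F_z)| ≤ E_D(g^{xy}, b^z)`** in the whitened Lebesgue format, any admissible `D`. [folklore] -/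
theorem hessgrad_cov_entry_raw (hUd : ∀ φ : EuclideanSpace ℝ ι, HasFDerivAt U (U' φ) φ) (hU'd : ∀ φ : EuclideanSpace ℝ ι, HasFDerivAt U' (U'' φ) φ)
    (hU''d : ∀ φ : EuclideanSpace ℝ ι, HasFDerivAt U'' (U₃ φ) φ)
    (hHk : ∀ (φ : EuclideanSpace ℝ ι) (x z : ι), |U'' φ (EuclideanSpace.single z (1 : ℝ)) (EuclideanSpace.single x (1 : ℝ))| ≤ Hk x z)
    (hHk0 : ∀ v u, 0 ≤ Hk v u)
    (hK3 : ∀ (φ : EuclideanSpace ℝ ι) (u x y : ι),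
      |U₃ φ (EuclideanSpace.single u (1 : ℝ)) (EuclideanSpace.single x (1 : ℝ)) (EuclideanSpace.single y (1 : ℝ))| ≤ K3 x y u)
    (A : Matrix ι κ ℝ) (ψ : EuclideanSpace ℝ ι)
    (hlam : ∀ x : κ, ∑ u, ∑ v, |A u x| * |A v x| * Hk v u ≤ lamA) (hlam1 : lamA < 1)
    (hrow : ∀ x : κ, ∑ w, (if w = x then 0 else ∑ u, ∑ v, |A u w| * |A v x| * Hk v u) / (1 - lamA) ≤ γ) (hγ0 : 0 ≤ γ) (hγ1 : γ < 1)
    (hD : ∀ x y, 0 ≤ D x y)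
    (hDC : ∀ x y, (if x = y then (1 : ℝ) else 0) + ∑ z, D x z * ((if y = z then 0 else ∑ u, ∑ v, |A u y| * |A v z| * Hk v u) / (1 - lamA)) ≤ D x y)
    (hI0 : Integrable (fun ξ : EuclideanSpace ℝ κ => exp (-U (matrixCLM A ξ + ψ))) (multivariateGaussian 0 (1 : Matrix κ κ ℝ)))
    (hI2 : ∀ w, Integrable (fun ξ : EuclideanSpace ℝ κ => exp (-U (matrixCLM A ξ + ψ)) * ξ w ^ 2) (multivariateGaussian 0 (1 : Matrix κ κ ℝ)))
    (x y z : ι) :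
    |∫ w, U'' (matrixCLM A (WithLp.toLp 2 w) + ψ) (EuclideanSpace.single x (1 : ℝ)) (EuclideanSpace.single y (1 : ℝ)) *
            U' (matrixCLM A (WithLp.toLp 2 w) + ψ) (EuclideanSpace.single z (1 : ℝ))
          ∂((volume : Measure (κ → ℝ)).tilted fun z => -(1 / 2 * (z ⬝ᵥ z) + U (matrixCLM A (WithLp.toLp 2 z) + ψ))) -
        (∫ w, U'' (matrixCLM A (WithLp.toLp 2 w) + ψ) (EuclideanSpace.single x (1 : ℝ)) (EuclideanSpace.single y (1 : ℝ))
          ∂((volume : Measure (κ → ℝ)).tilted fun z => -(1 / 2 * (z ⬝ᵥ z) + U (matrixCLM A (WithLp.toLp 2 z) + ψ)))) *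
        (∫ w, U' (matrixCLM A (WithLp.toLp 2 w) + ψ) (EuclideanSpace.single z (1 : ℝ))
          ∂((volume : Measure (κ → ℝ)).tilted fun z => -(1 / 2 * (z ⬝ᵥ z) + U (matrixCLM A (WithLp.toLp 2 z) + ψ))))| ≤
      ∑ w, (∑ z', D z' w * ∑ u, |A u z'| * K3 x y u) * (∑ z', D z' w * ∑ u, |A u z'| * Hk z u) / (1 - lamA) := by
  have hcpos : ∀ _x : κ, 0 < 1 - lamA := fun _ => by linarith
  have hV0 : Integrable (fun z : κ → ℝ => exp (-(1 / 2 * (z ⬝ᵥ z) + U (matrixCLM A (WithLp.toLp 2 z) + ψ)))) := by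
    have h := whitened_integrable_lebesgue A ψ (k := fun _ => (1 : ℝ)) (by simpa only [mul_one] using hI0)
    simpa only [one_mul] using h
  have hV2 : ∀ w, Integrable (fun z : κ → ℝ => z w ^ 2 * exp (-(1 / 2 * (z ⬝ᵥ z) + U (matrixCLM A (WithLp.toLp 2 z) + ψ)))) := fun w => by
    have h := whitened_integrable_lebesgue A ψ (k := fun ξ : EuclideanSpace ℝ κ => ξ w ^ 2) (hI2 w)
    simpa only [PiLp.toLp_apply] using h
  have hJ : ∀ x w : κ, 0 ≤ (if w = x then (0 : ℝ) else ∑ u, ∑ v, |A u w| * |A v x| * Hk v u) := fun x w => by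
    split_ifs
    · exact le_rfl
    · exact whitened_cross_nonneg hHk0 A x w
  exact abs_cov_le_kernel_gibbs
    (P := fun x F ω => (∫ s, F (update ω x s) * exp (-(1 / 2 * (update ω x s ⬝ᵥ update ω x s) + U (matrixCLM A (WithLp.toLp 2 (update ω x s)) + ψ)))) /
      ∫ s, exp (-(1 / 2 * (update ω x s ⬝ᵥ update ω x s) + U (matrixCLM A (WithLp.toLp 2 (update ω x s)) + ψ))))
    (V := fun z => 1 / 2 * (z ⬝ᵥ z) + U (matrixCLM A (WithLp.toLp 2 z) + ψ))
    (V₁ := fun x z => z x + U' (matrixCLM A (WithLp.toLp 2 z) + ψ) (matrixCLM A (EuclideanSpace.single x (1 : ℝ))))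
    (c := fun _ => 1 - lamA) (Cw := 1 + lamA) (J := fun x w => if w = x then 0 else ∑ u, ∑ v, |A u w| * |A v x| * Hk v u) (γ := γ) (D := D)
    (F := fun w => U'' (matrixCLM A (WithLp.toLp 2 w) + ψ) (EuclideanSpace.single x (1 : ℝ)) (EuclideanSpace.single y (1 : ℝ)))
    (G := fun w => U' (matrixCLM A (WithLp.toLp 2 w) + ψ) (EuclideanSpace.single z (1 : ℝ)))
    (a := fun w => ∑ u, |A u w| * K3 x y u) (b := fun w => ∑ u, |A u w| * Hk z u)
    (fun _ _ _ => rfl) (fun x z => whitenedV_hasDerivAt hUd A ψ x z) (fun x z s t => whitenedV_floor hU'd hHk A hlam ψ x z s t) hcpos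
    (fun x z s t => whitenedV_ceiling hU'd hHk A hlam ψ x z s t)
    (fun x w hw z s t => by rw [if_neg hw]; exact whitenedV_cross hU'd hHk A ψ x w hw z s t)
    (whitenedV_continuous hUd A ψ) hV0 hV2 hJ (fun x => by simp) hrow hγ0 hγ1 hD hDC
    (fun w z' s t => hessian_obs_lipVec hU''d hK3 A ψ x y w z' s t) (fun w z' s t => whitened_obs_lipVec hU'd hHk A ψ z w z' s t)

/-- **`|Cov_ν(F_x, G_{yz})| ≤ E_D(b^x, g^{yz})`** in the whitened Lebesgue format, any admissible `D`. [folklore] -/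
theorem gradhess_cov_entry_raw (hUd : ∀ φ : EuclideanSpace ℝ ι, HasFDerivAt U (U' φ) φ) (hU'd : ∀ φ : EuclideanSpace ℝ ι, HasFDerivAt U' (U'' φ) φ)
    (hU''d : ∀ φ : EuclideanSpace ℝ ι, HasFDerivAt U'' (U₃ φ) φ)
    (hHk : ∀ (φ : EuclideanSpace ℝ ι) (x z : ι), |U'' φ (EuclideanSpace.single z (1 : ℝ)) (EuclideanSpace.single x (1 : ℝ))| ≤ Hk x z)
    (hHk0 : ∀ v u, 0 ≤ Hk v u)
    (hK3 : ∀ (φ : EuclideanSpace ℝ ι) (u x y : ι),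
      |U₃ φ (EuclideanSpace.single u (1 : ℝ)) (EuclideanSpace.single x (1 : ℝ)) (EuclideanSpace.single y (1 : ℝ))| ≤ K3 x y u)
    (A : Matrix ι κ ℝ) (ψ : EuclideanSpace ℝ ι)
    (hlam : ∀ x : κ, ∑ u, ∑ v, |A u x| * |A v x| * Hk v u ≤ lamA) (hlam1 : lamA < 1)
    (hrow : ∀ x : κ, ∑ w, (if w = x then 0 else ∑ u, ∑ v, |A u w| * |A v x| * Hk v u) / (1 - lamA) ≤ γ) (hγ0 : 0 ≤ γ) (hγ1 : γ < 1)
    (hD : ∀ x y, 0 ≤ D x y)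
    (hDC : ∀ x y, (if x = y then (1 : ℝ) else 0) + ∑ z, D x z * ((if y = z then 0 else ∑ u, ∑ v, |A u y| * |A v z| * Hk v u) / (1 - lamA)) ≤ D x y)
    (hI0 : Integrable (fun ξ : EuclideanSpace ℝ κ => exp (-U (matrixCLM A ξ + ψ))) (multivariateGaussian 0 (1 : Matrix κ κ ℝ)))
    (hI2 : ∀ w, Integrable (fun ξ : EuclideanSpace ℝ κ => exp (-U (matrixCLM A ξ + ψ)) * ξ w ^ 2) (multivariateGaussian 0 (1 : Matrix κ κ ℝ)))
    (x y z : ι) :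
    |∫ w, U' (matrixCLM A (WithLp.toLp 2 w) + ψ) (EuclideanSpace.single x (1 : ℝ)) *
            U'' (matrixCLM A (WithLp.toLp 2 w) + ψ) (EuclideanSpace.single y (1 : ℝ)) (EuclideanSpace.single z (1 : ℝ))
          ∂((volume : Measure (κ → ℝ)).tilted fun z => -(1 / 2 * (z ⬝ᵥ z) + U (matrixCLM A (WithLp.toLp 2 z) + ψ))) -
        (∫ w, U' (matrixCLM A (WithLp.toLp 2 w) + ψ) (EuclideanSpace.single x (1 : ℝ))
          ∂((volume : Measure (κ → ℝ)).tilted fun z => -(1 / 2 * (z ⬝ᵥ z) + U (matrixCLM A (WithLp.toLp 2 z) + ψ)))) *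
        (∫ w, U'' (matrixCLM A (WithLp.toLp 2 w) + ψ) (EuclideanSpace.single y (1 : ℝ)) (EuclideanSpace.single z (1 : ℝ))
          ∂((volume : Measure (κ → ℝ)).tilted fun z => -(1 / 2 * (z ⬝ᵥ z) + U (matrixCLM A (WithLp.toLp 2 z) + ψ))))| ≤
      ∑ w, (∑ z', D z' w * ∑ u, |A u z'| * Hk x u) * (∑ z', D z' w * ∑ u, |A u z'| * K3 y z u) / (1 - lamA) := by
  have hcpos : ∀ _x : κ, 0 < 1 - lamA := fun _ => by linarith
  have hV0 : Integrable (fun z : κ → ℝ => exp (-(1 / 2 * (z ⬝ᵥ z) + U (matrixCLM A (WithLp.toLp 2 z) + ψ)))) := by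
    have h := whitened_integrable_lebesgue A ψ (k := fun _ => (1 : ℝ)) (by simpa only [mul_one] using hI0)
    simpa only [one_mul] using h
  have hV2 : ∀ w, Integrable (fun z : κ → ℝ => z w ^ 2 * exp (-(1 / 2 * (z ⬝ᵥ z) + U (matrixCLM A (WithLp.toLp 2 z) + ψ)))) := fun w => by
    have h := whitened_integrable_lebesgue A ψ (k := fun ξ : EuclideanSpace ℝ κ => ξ w ^ 2) (hI2 w)
    simpa only [PiLp.toLp_apply] using h
  have hJ : ∀ x w : κ, 0 ≤ (if w = x then (0 : ℝ) else ∑ u, ∑ v, |A u w| * |A v x| * Hk v u) := fun x w => by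
    split_ifs
    · exact le_rfl
    · exact whitened_cross_nonneg hHk0 A x w
  exact abs_cov_le_kernel_gibbs
    (P := fun x F ω => (∫ s, F (update ω x s) * exp (-(1 / 2 * (update ω x s ⬝ᵥ update ω x s) + U (matrixCLM A (WithLp.toLp 2 (update ω x s)) + ψ)))) /
      ∫ s, exp (-(1 / 2 * (update ω x s ⬝ᵥ update ω x s) + U (matrixCLM A (WithLp.toLp 2 (update ω x s)) + ψ))))
    (V := fun z => 1 / 2 * (z ⬝ᵥ z) + U (matrixCLM A (WithLp.toLp 2 z) + ψ))
    (V₁ := fun x z => z x + U' (matrixCLM A (WithLp.toLp 2 z) + ψ) (matrixCLM A (EuclideanSpace.single x (1 : ℝ))))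
    (c := fun _ => 1 - lamA) (Cw := 1 + lamA) (J := fun x w => if w = x then 0 else ∑ u, ∑ v, |A u w| * |A v x| * Hk v u) (γ := γ) (D := D)
    (F := fun w => U' (matrixCLM A (WithLp.toLp 2 w) + ψ) (EuclideanSpace.single x (1 : ℝ)))
    (G := fun w => U'' (matrixCLM A (WithLp.toLp 2 w) + ψ) (EuclideanSpace.single y (1 : ℝ)) (EuclideanSpace.single z (1 : ℝ)))
    (a := fun w => ∑ u, |A u w| * Hk x u) (b := fun w => ∑ u, |A u w| * K3 y z u)
    (fun _ _ _ => rfl) (fun x z => whitenedV_hasDerivAt hUd A ψ x z) (fun x z s t => whitenedV_floor hU'd hHk A hlam ψ x z s t) hcpos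
    (fun x z s t => whitenedV_ceiling hU'd hHk A hlam ψ x z s t)
    (fun x w hw z s t => by rw [if_neg hw]; exact whitenedV_cross hU'd hHk A ψ x w hw z s t)
    (whitenedV_continuous hUd A ψ) hV0 hV2 hJ (fun x => by simp) hrow hγ0 hγ1 hD hDC
    (fun w z' s t => whitened_obs_lipVec hU'd hHk A ψ x w z' s t) (fun w z' s t => hessian_obs_lipVec hU''d hK3 A ψ y z w z' s t)

/-! ## §2. THE END: the entries under `N(0, AAᵀ)` -/

/-- **`|Z⁻¹∫e^{−U}U″e_xe_y·U′e_z − Z⁻²(∫e^{−U}U″e_xe_y)(∫e^{−U}U′e_z)| ≤ E_D(g^{xy}, b^z)`** under `N(0,AAᵀ)`, any admissible `D`, the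
moment letters discharged by (458), Dobrushin's row condition from the letters `αc·hr·αr ≤ γ(1−lamA)`. [folklore] -/
theorem hessgrad_cov_entry [Nonempty κ] (hΓop : (γop • (1 : Matrix ι ι ℝ) - A * Aᵀ).PosSemidef) (Y : Finset ι)
    (hUd : ∀ φ : EuclideanSpace ℝ ι, HasFDerivAt U (U' φ) φ) (hU'd : ∀ φ : EuclideanSpace ℝ ι, HasFDerivAt U' (U'' φ) φ)
    (hU''d : ∀ φ : EuclideanSpace ℝ ι, HasFDerivAt U'' (U₃ φ) φ)
    (hHk : ∀ (φ : EuclideanSpace ℝ ι) (x z : ι), |U'' φ (EuclideanSpace.single z (1 : ℝ)) (EuclideanSpace.single x (1 : ℝ))| ≤ Hk x z)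
    (hHk0 : ∀ v u, 0 ≤ Hk v u)
    (hK3 : ∀ (φ : EuclideanSpace ℝ ι) (u x y : ι),
      |U₃ φ (EuclideanSpace.single u (1 : ℝ)) (EuclideanSpace.single x (1 : ℝ)) (EuclideanSpace.single y (1 : ℝ))| ≤ K3 x y u)
    (hκ₀ : 0 ≤ κ₀) (hτ : 0 < τ) (hδ : 0 < δ) (hθ1 : θ < 1) (hκθ : 2 * κ₀ * (1 + τ) * γop ≤ θ)
    (hκθw : 2 * κ₀ * (1 + τ) * γop + 4 * δ ≤ θ) (hstab : ∀ φ : EuclideanSpace ℝ ι, -(κ₀ * ∑ x ∈ Y, φ x ^ 2) ≤ U φ) (ψ : EuclideanSpace ℝ ι)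
    (hαr : ∀ u, ∑ w, |A u w| ≤ αr) (hαc : ∀ w, ∑ u, |A u w| ≤ αc) (hhr : ∀ v, ∑ u, Hk v u ≤ hr)
    (hlam : ∀ x : κ, ∑ u, ∑ v, |A u x| * |A v x| * Hk v u ≤ lamA) (hlam1 : lamA < 1) (hγ : αc * hr * αr / (1 - lamA) ≤ γ) (hγ1 : γ < 1)
    (hD : ∀ x y, 0 ≤ D x y)
    (hDC : ∀ x y, (if x = y then (1 : ℝ) else 0) + ∑ z, D x z * ((if y = z then 0 else ∑ u, ∑ v, |A u y| * |A v z| * Hk v u) / (1 - lamA)) ≤ D x y)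
    (x y z : ι) :
    |((∫ ω : EuclideanSpace ℝ ι, exp (-U (ω + ψ)) ∂(multivariateGaussian 0 (A * Aᵀ)))⁻¹ * (∫ ω : EuclideanSpace ℝ ι, exp (-U (ω + ψ)) *
          (U'' (ω + ψ) (EuclideanSpace.single x (1 : ℝ)) (EuclideanSpace.single y (1 : ℝ)) * U' (ω + ψ) (EuclideanSpace.single z (1 : ℝ)))
            ∂(multivariateGaussian 0 (A * Aᵀ))) - ((∫ ω : EuclideanSpace ℝ ι, exp (-U (ω + ψ)) ∂(multivariateGaussian 0 (A * Aᵀ))) ^ 2)⁻¹ *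
          ((∫ ω : EuclideanSpace ℝ ι, exp (-U (ω + ψ)) * U'' (ω + ψ) (EuclideanSpace.single x (1 : ℝ)) (EuclideanSpace.single y (1 : ℝ))
            ∂(multivariateGaussian 0 (A * Aᵀ))) * (∫ ω : EuclideanSpace ℝ ι, exp (-U (ω + ψ)) * U' (ω + ψ) (EuclideanSpace.single z (1 : ℝ))
            ∂(multivariateGaussian 0 (A * Aᵀ)))))| ≤
      ∑ w, (∑ z', D z' w * ∑ u, |A u z'| * K3 x y u) * (∑ z', D z' w * ∑ u, |A u z'| * Hk z u) / (1 - lamA) := by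
  haveI : Nonempty ι := ⟨x⟩
  obtain ⟨w₀⟩ := ‹Nonempty κ›
  have hUc : Continuous U := continuous_iff_continuousAt.2 fun φ => (hUd φ).continuousAt
  have hU'c : Continuous U' := continuous_iff_continuousAt.2 fun φ => (hU'd φ).continuousAt
  have hU''c : Continuous U'' := continuous_iff_continuousAt.2 fun φ => (hU''d φ).continuousAt
  have hl1 : 0 < 1 - lamA := by linarith
  have hrow : ∀ x : κ, ∑ w, (if w = x then 0 else ∑ u, ∑ v, |A u w| * |A v x| * Hk v u) / (1 - lamA) ≤ γ := fun x => by
    rw [← Finset.sum_div]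
    refine le_trans (div_le_div_of_nonneg_right ?_ hl1.le) hγ
    refine le_trans (Finset.sum_le_sum fun w _ => ?_) (whitened_J_rowsum_le hHk0 hαr hαc hhr x)
    split_ifs
    · exact le_rfl
    · linarith [abs_nonneg ((1 : Matrix κ κ ℝ) x w)]
  have hγ0 : 0 ≤ γ := by
    refine le_trans (Finset.sum_nonneg fun w _ => div_nonneg ?_ hl1.le) (hrow w₀)
    split_ifs
    · exact le_rfl
    · exact whitened_cross_nonneg hHk0 A w₀ w
  have hI0 := whitened_exp_integrable hΓop Y hUc.measurable hκ₀ hτ hθ1 hκθ hstab ψ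
  have hI2 := fun w => whitened_second_moment_integrable hΓop Y hUc.measurable hκ₀ hτ hδ hθ1 hκθw hstab ψ w
  have h := hessgrad_cov_entry_raw hUd hU'd hU''d hHk hHk0 hK3 A ψ hlam hlam1 hrow hγ0 hγ1 hD hDC hI0 hI2 x y z
  have hsh : Continuous fun ω : EuclideanSpace ℝ ι => ω + ψ := continuous_id.add continuous_const
  have he : Continuous fun ω : EuclideanSpace ℝ ι => exp (-U (ω + ψ)) := continuous_exp.comp (hUc.comp hsh).neg
  have hg : ∀ v : ι, Continuous fun ω : EuclideanSpace ℝ ι => U' (ω + ψ) (EuclideanSpace.single v (1 : ℝ)) := fun v =>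
    (hU'c.comp hsh).clm_apply continuous_const
  have hG : ∀ v w : ι, Continuous fun ω : EuclideanSpace ℝ ι => U'' (ω + ψ) (EuclideanSpace.single v (1 : ℝ)) (EuclideanSpace.single w (1 : ℝ)) :=
    fun v w => ((hU''c.comp hsh).clm_apply continuous_const).clm_apply continuous_const
  have hm0 : AEStronglyMeasurable (fun ω : EuclideanSpace ℝ ι => exp (-U (ω + ψ))) (multivariateGaussian 0 (A * Aᵀ)) := he.aestronglyMeasurable
  have hm1 : AEStronglyMeasurable (fun ω : EuclideanSpace ℝ ι => exp (-U (ω + ψ)) * U' (ω + ψ) (EuclideanSpace.single z (1 : ℝ)))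
      (multivariateGaussian 0 (A * Aᵀ)) := (he.mul (hg z)).aestronglyMeasurable
  have hmG : AEStronglyMeasurable (fun ω : EuclideanSpace ℝ ι => exp (-U (ω + ψ)) * U'' (ω + ψ) (EuclideanSpace.single x (1 : ℝ))
      (EuclideanSpace.single y (1 : ℝ))) (multivariateGaussian 0 (A * Aᵀ)) := (he.mul (hG x y)).aestronglyMeasurable
  have hm2 : AEStronglyMeasurable (fun ω : EuclideanSpace ℝ ι => exp (-U (ω + ψ)) * (U'' (ω + ψ) (EuclideanSpace.single x (1 : ℝ))
      (EuclideanSpace.single y (1 : ℝ)) * U' (ω + ψ) (EuclideanSpace.single z (1 : ℝ)))) (multivariateGaussian 0 (A * Aᵀ)) :=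
    (he.mul ((hG x y).mul (hg z))).aestronglyMeasurable
  refine le_trans (le_of_eq ?_) h
  rw [whitened_tilted_eq_gauss A ψ, whitened_tilted_eq_gauss A ψ, whitened_tilted_eq_gauss A ψ]
  simp only [WithLp.toLp_ofLp]
  rw [whitened_integral_eq A hm0, whitened_integral_eq A hm2, whitened_integral_eq A hmG, whitened_integral_eq A hm1]
  congr 1
  ring

/-- **`|Z⁻¹∫e^{−U}U′e_x·U″e_ye_z − Z⁻²(∫e^{−U}U′e_x)(∫e^{−U}U″e_ye_z)| ≤ E_D(b^x, g^{yz})`** under `N(0,AAᵀ)`, any admissible `D`.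
[folklore] -/
theorem gradhess_cov_entry [Nonempty κ] (hΓop : (γop • (1 : Matrix ι ι ℝ) - A * Aᵀ).PosSemidef) (Y : Finset ι)
    (hUd : ∀ φ : EuclideanSpace ℝ ι, HasFDerivAt U (U' φ) φ) (hU'd : ∀ φ : EuclideanSpace ℝ ι, HasFDerivAt U' (U'' φ) φ)
    (hU''d : ∀ φ : EuclideanSpace ℝ ι, HasFDerivAt U'' (U₃ φ) φ)
    (hHk : ∀ (φ : EuclideanSpace ℝ ι) (x z : ι), |U'' φ (EuclideanSpace.single z (1 : ℝ)) (EuclideanSpace.single x (1 : ℝ))| ≤ Hk x z)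
    (hHk0 : ∀ v u, 0 ≤ Hk v u)
    (hK3 : ∀ (φ : EuclideanSpace ℝ ι) (u x y : ι),
      |U₃ φ (EuclideanSpace.single u (1 : ℝ)) (EuclideanSpace.single x (1 : ℝ)) (EuclideanSpace.single y (1 : ℝ))| ≤ K3 x y u)
    (hκ₀ : 0 ≤ κ₀) (hτ : 0 < τ) (hδ : 0 < δ) (hθ1 : θ < 1) (hκθ : 2 * κ₀ * (1 + τ) * γop ≤ θ)
    (hκθw : 2 * κ₀ * (1 + τ) * γop + 4 * δ ≤ θ) (hstab : ∀ φ : EuclideanSpace ℝ ι, -(κ₀ * ∑ x ∈ Y, φ x ^ 2) ≤ U φ) (ψ : EuclideanSpace ℝ ι)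
    (hαr : ∀ u, ∑ w, |A u w| ≤ αr) (hαc : ∀ w, ∑ u, |A u w| ≤ αc) (hhr : ∀ v, ∑ u, Hk v u ≤ hr)
    (hlam : ∀ x : κ, ∑ u, ∑ v, |A u x| * |A v x| * Hk v u ≤ lamA) (hlam1 : lamA < 1) (hγ : αc * hr * αr / (1 - lamA) ≤ γ) (hγ1 : γ < 1)
    (hD : ∀ x y, 0 ≤ D x y)
    (hDC : ∀ x y, (if x = y then (1 : ℝ) else 0) + ∑ z, D x z * ((if y = z then 0 else ∑ u, ∑ v, |A u y| * |A v z| * Hk v u) / (1 - lamA)) ≤ D x y)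
    (x y z : ι) :
    |((∫ ω : EuclideanSpace ℝ ι, exp (-U (ω + ψ)) ∂(multivariateGaussian 0 (A * Aᵀ)))⁻¹ * (∫ ω : EuclideanSpace ℝ ι, exp (-U (ω + ψ)) *
          (U' (ω + ψ) (EuclideanSpace.single x (1 : ℝ)) * U'' (ω + ψ) (EuclideanSpace.single y (1 : ℝ)) (EuclideanSpace.single z (1 : ℝ)))
            ∂(multivariateGaussian 0 (A * Aᵀ))) - ((∫ ω : EuclideanSpace ℝ ι, exp (-U (ω + ψ)) ∂(multivariateGaussian 0 (A * Aᵀ))) ^ 2)⁻¹ *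
          ((∫ ω : EuclideanSpace ℝ ι, exp (-U (ω + ψ)) * U' (ω + ψ) (EuclideanSpace.single x (1 : ℝ)) ∂(multivariateGaussian 0 (A * Aᵀ))) *
            (∫ ω : EuclideanSpace ℝ ι, exp (-U (ω + ψ)) * U'' (ω + ψ) (EuclideanSpace.single y (1 : ℝ)) (EuclideanSpace.single z (1 : ℝ))
              ∂(multivariateGaussian 0 (A * Aᵀ)))))| ≤
      ∑ w, (∑ z', D z' w * ∑ u, |A u z'| * Hk x u) * (∑ z', D z' w * ∑ u, |A u z'| * K3 y z u) / (1 - lamA) := by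
  haveI : Nonempty ι := ⟨x⟩
  obtain ⟨w₀⟩ := ‹Nonempty κ›
  have hUc : Continuous U := continuous_iff_continuousAt.2 fun φ => (hUd φ).continuousAt
  have hU'c : Continuous U' := continuous_iff_continuousAt.2 fun φ => (hU'd φ).continuousAt
  have hU''c : Continuous U'' := continuous_iff_continuousAt.2 fun φ => (hU''d φ).continuousAt
  have hl1 : 0 < 1 - lamA := by linarith
  have hrow : ∀ x : κ, ∑ w, (if w = x then 0 else ∑ u, ∑ v, |A u w| * |A v x| * Hk v u) / (1 - lamA) ≤ γ := fun x => by
    rw [← Finset.sum_div]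
    refine le_trans (div_le_div_of_nonneg_right ?_ hl1.le) hγ
    refine le_trans (Finset.sum_le_sum fun w _ => ?_) (whitened_J_rowsum_le hHk0 hαr hαc hhr x)
    split_ifs
    · exact le_rfl
    · linarith [abs_nonneg ((1 : Matrix κ κ ℝ) x w)]
  have hγ0 : 0 ≤ γ := by
    refine le_trans (Finset.sum_nonneg fun w _ => div_nonneg ?_ hl1.le) (hrow w₀)
    split_ifs
    · exact le_rfl
    · exact whitened_cross_nonneg hHk0 A w₀ w
  have hI0 := whitened_exp_integrable hΓop Y hUc.measurable hκ₀ hτ hθ1 hκθ hstab ψ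
  have hI2 := fun w => whitened_second_moment_integrable hΓop Y hUc.measurable hκ₀ hτ hδ hθ1 hκθw hstab ψ w
  have h := gradhess_cov_entry_raw hUd hU'd hU''d hHk hHk0 hK3 A ψ hlam hlam1 hrow hγ0 hγ1 hD hDC hI0 hI2 x y z
  have hsh : Continuous fun ω : EuclideanSpace ℝ ι => ω + ψ := continuous_id.add continuous_const
  have he : Continuous fun ω : EuclideanSpace ℝ ι => exp (-U (ω + ψ)) := continuous_exp.comp (hUc.comp hsh).neg
  have hg : ∀ v : ι, Continuous fun ω : EuclideanSpace ℝ ι => U' (ω + ψ) (EuclideanSpace.single v (1 : ℝ)) := fun v =>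
    (hU'c.comp hsh).clm_apply continuous_const
  have hG : ∀ v w : ι, Continuous fun ω : EuclideanSpace ℝ ι => U'' (ω + ψ) (EuclideanSpace.single v (1 : ℝ)) (EuclideanSpace.single w (1 : ℝ)) :=
    fun v w => ((hU''c.comp hsh).clm_apply continuous_const).clm_apply continuous_const
  have hm0 : AEStronglyMeasurable (fun ω : EuclideanSpace ℝ ι => exp (-U (ω + ψ))) (multivariateGaussian 0 (A * Aᵀ)) := he.aestronglyMeasurable
  have hm1 : AEStronglyMeasurable (fun ω : EuclideanSpace ℝ ι => exp (-U (ω + ψ)) * U' (ω + ψ) (EuclideanSpace.single x (1 : ℝ)))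
      (multivariateGaussian 0 (A * Aᵀ)) := (he.mul (hg x)).aestronglyMeasurable
  have hmG : AEStronglyMeasurable (fun ω : EuclideanSpace ℝ ι => exp (-U (ω + ψ)) * U'' (ω + ψ) (EuclideanSpace.single y (1 : ℝ))
      (EuclideanSpace.single z (1 : ℝ))) (multivariateGaussian 0 (A * Aᵀ)) := (he.mul (hG y z)).aestronglyMeasurable
  have hm2 : AEStronglyMeasurable (fun ω : EuclideanSpace ℝ ι => exp (-U (ω + ψ)) * (U' (ω + ψ) (EuclideanSpace.single x (1 : ℝ)) *
      U'' (ω + ψ) (EuclideanSpace.single y (1 : ℝ)) (EuclideanSpace.single z (1 : ℝ)))) (multivariateGaussian 0 (A * Aᵀ)) :=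
    (he.mul ((hg x).mul (hG y z))).aestronglyMeasurable
  refine le_trans (le_of_eq ?_) h
  rw [whitened_tilted_eq_gauss A ψ, whitened_tilted_eq_gauss A ψ, whitened_tilted_eq_gauss A ψ]
  simp only [WithLp.toLp_ofLp]
  rw [whitened_integral_eq A hm0, whitened_integral_eq A hm2, whitened_integral_eq A hm1, whitened_integral_eq A hmG]
  congr 1
  ring

/-! ## §3. Toy -/

/-- Toy (the shape of `E_D(a,b)` at one sampler index, `D = 1`, `c = 1`): `a·b∕1 = ab`. -/
example (a b : ℝ) : (1 * a) * (1 * b) / (1 - 0) = a * b := by ring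

end Summit.QuantumFields.BalabanUV.T4Continuum.NE7b.SupWhitenedTwoPointEntries

end
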